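import Summits.ResolutionOfSingularities.ResolutionOfSingularities.Theorems.DeltaCutMirrorTransport2
import Literature.AlgebraicGeometry.Resolution.BlowupSequencesComapMarked
import Literature.AlgebraicGeometry.Resolution.MarkedIdealsEtale
import HarnessLib

/-!
# DeltaCutMirrorTransport3 — the TRANSPORT FILE, part 3 (§T7–§T8): THE HOPS ARE EQUIVARIANT

Tree slice 3/3 of the HOME file
`run/shared/lean/pub/decomp-res/decomp-res-lens-6/g29/transport/MirrorTransport.lean` (verbatim §T7–§T8).
§T7 blow-ups of corresponding centres along an isomorphism are isomorphic OVER it, with controlled transforms and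
the resolve step's memory
carried (`exists_blowupIso_of_isIso` from Literature `blowup.comapMap` / `blowup.isPullback_comapMap` /
`comap_controlledTransform_of_flat`;
`RefStage.comapAlong`, `RefStageIso.eq_comapAlong`; law-agnostic `RefStageIso.exists_centreStepIso`); §T8 the
separating hop (stay / step 1 / steps 1+2), the refined hop (every branch) and the
graded hop have isomorphic successors along a `RefStageIso` (`RefStageIso.exists_gHopIso`, `.exists_refHopIso`,
`.exists_sepIso`) — the
SUCCESSOR half of the iso-equivariance axiom (e) for local centre laws, PROVED.  TOOL, landable at 0 (row 218).  No
`sorry`, no new axiom,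
no instance, no notation. [new; elementary] [folklore]
-/

noncomputable section

open CategoryTheory CategoryTheory.Limits AlgebraicGeometry TopologicalSpace IsLocalRing
open Literature.AlgebraicGeometry.Resolution

universe u

namespace Summit.ResolutionOfSingularities.ResolutionOfSingularities.Theorems.DeltaCutClasses

open Summit.ResolutionOfSingularities.ResolutionOfSingularities.Theorems.TwistCutClasses
open Summit.ResolutionOfSingularities.ResolutionOfSingularities.Theorems.LightCutClasses
open Summit.ResolutionOfSingularities.ResolutionOfSingularities.Theorems
open WeakOrderReduction ForcedTowerClasses SubfieldContactClasses AbsoluteContactClasses PurityValveClasses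

section MTransportBlowup

open Scheme.IdealSheafData (vanishingIdeal)

/-! #### §T7 — BLOW-UP SUCCESSORS along isomorphisms: the blow-ups of corresponding centres are isomorphic OVER the
base isomorphism,
the controlled transforms correspond (flat base change, `MarkedIdealsEtale.comap_controlledTransform_of_flat`), and
so do the hops' new pending
sets; packaged as `RefStageIso`s between the successors of `RefStage.exit` / `RefStage.resolve` / the graded hop's
firing branch -/

variable {X Y : Scheme.{0}}

/-- **BLOWING UP COMMUTES WITH ISOMORPHISMS, WITH TRANSFORMS**: along an isomorphism `f : X ⟶ Y` and centres `C' =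
f⁻¹C`, there is an
isomorphism `e : Bl_{C'} X ≅ Bl_C Y` over `f` along which the controlled transform of `(𝓘, n)` pulls back to the
controlled transform of
`(f⁻¹𝓘, n)` (Literature: `blowup.comapMap`, `blowup.isPullback_comapMap`, `comap_controlledTransform_of_flat`). [folklore] -/
theorem exists_blowupIso_of_isIso (f : X ⟶ Y) [IsIso f] [IsLocallyNoetherian X] [IsLocallyNoetherian Y]
    (C I : Y.IdealSheafData) {C' : X.IdealSheafData} (hC : C' = C.comap f) (n : ℕ) :
    ∃ e : blowup C' ≅ blowup C, e.hom ≫ blowup.π C = blowup.π C' ≫ f ∧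
      (controlledTransform (blowup.π C) C I n).comap e.hom = controlledTransform (blowup.π C') C' (I.comap f) n := by
  subst hC
  haveI : IsIso (blowup.comapMap C f) := (blowup.isPullback_comapMap C f).isIso_fst_of_isIso
  haveI : IsLocallyNoetherian (blowup C) := (blowup.isBlowup C).isLocallyNoetherian
  haveI : IsLocallyNoetherian (blowup (C.comap f)) := (blowup.isBlowup (C.comap f)).isLocallyNoetherian
  exact ⟨asIso (blowup.comapMap C f), blowup.comapMap_π C f, comap_controlledTransform_of_flat f (blowup.comapMap_π C f) C I n⟩

/-- **THE PULLED-BACK REFINED STAGE** along a morphism into the base: `(Y', f⁻¹𝓘, f⁻¹ pending)` (an `abbrev`, so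
that instances on `Y'`
are found on `(R.comapAlong f).base.Y`). DEFINITION (support). -/
abbrev RefStage.comapAlong (R : RefStage) {Y' : Scheme.{0}} (f : Y' ⟶ R.base.Y) : RefStage :=
  ⟨⟨Y', R.base.I.comap f⟩, R.pending.map fun S => S.preimage f.base.hom.continuous⟩

/-- the tautological `RefStageIso` of a pulled-back refined stage along an isomorphism. DEFINITION (support). -/
def RefStageIso.ofComapAlong (R : RefStage) {Y' : Scheme.{0}} (f : Y' ⟶ R.base.Y) [IsIso f] : RefStageIso R (R.comapAlong f) :=
  ⟨asIso f, rfl, rfl⟩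

/-- **every `RefStageIso` IS a pull-back**: `R' = R.comapAlong φ` — so successor statements may be (and below are) phrased for
`R.comapAlong f`. [folklore] -/
theorem RefStageIso.eq_comapAlong {R R' : RefStage} (φ : RefStageIso R R') : R' = R.comapAlong φ.iso.hom := by
  cases R' with
  | mk base pending =>
    cases base with
    | mk Y I =>
      obtain ⟨e, hI, hP⟩ := φ
      dsimp only at e hI hP ⊢
      subst hI
      rw [hP]

variable (R : RefStage) {Y' : Scheme.{0}} (f : Y' ⟶ R.base.Y) [IsIso f] [IsLocallyNoetherian Y'] [IsLocallyNoetherian R.base.Y] (n : ℕ)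

/-- **THE EXIT HOP IS EQUIVARIANT**: along an isomorphism, the successor of `exit` at `S` and the successor of
`exit` at `f⁻¹S` on the
pulled-back stage are isomorphic refined stages, over the base isomorphism. [new] [folklore] -/
theorem RefStage.exists_exitIso_comapAlong (S : TopologicalSpace.Closeds R.base.Y) :
    ∃ ψ : RefStageIso (R.exit n S).next ((R.comapAlong f).exit n (S.preimage f.base.hom.continuous)).next,
      ψ.iso.hom ≫ blowup.π (vanishingIdeal S) = blowup.π (vanishingIdeal (S.preimage f.base.hom.continuous)) ≫ f := by
  obtain ⟨e, hsq, hct⟩ := exists_blowupIso_of_isIso f (vanishingIdeal S) R.base.I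
    (C' := vanishingIdeal (S.preimage f.base.hom.continuous)) (vanishingIdeal_comap_of_isIso f S).symm n
  exact ⟨⟨e, hct.symm, rfl⟩, hsq⟩

omit [IsLocallyNoetherian Y'] [IsLocallyNoetherian R.base.Y] in
/-- the new pending set of a resolve step is carried: `strictClosure (f⁻¹S) = e⁻¹ (strictClosure S)` for an
isomorphism `e` of the blow-ups
over `f`. [folklore] -/
theorem strictClosure_preimage_of_isIso (S : TopologicalSpace.Closeds R.base.Y)
    (e : blowup (singCentreOf (S.preimage f.base.hom.continuous)) ≅ blowup (singCentreOf S))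
    (hsq : e.hom ≫ blowup.π (singCentreOf S) = blowup.π (singCentreOf (S.preimage f.base.hom.continuous)) ≫ f) :
    strictClosure (N := (R.comapAlong f).base) (S.preimage f.base.hom.continuous) =
      (strictClosure (N := R.base) S).preimage e.hom.base.hom.continuous := by
  have hfun : ∀ x, (blowup.π (singCentreOf S)).base (e.hom.base x) =
      f.base ((blowup.π (singCentreOf (S.preimage f.base.hom.continuous))).base x) := fun x => by
    change (e.hom ≫ blowup.π _).base x = (blowup.π _ ≫ f).base x
    rw [hsq]
  apply TopologicalSpace.Closeds.ext
  simp only [strictClosure, TopologicalSpace.Closeds.coe_mk, TopologicalSpace.Closeds.coe_preimage]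
  rw [e.hom.isOpenEmbedding.isOpenMap.preimage_closure_eq_closure_preimage e.hom.base.hom.continuous]
  congr 1
  ext x
  simp only [Set.mem_preimage, Set.mem_sdiff, hfun, closure_singLocusOf_preimage_of_isIso]

/-- **THE RESOLVE HOP IS EQUIVARIANT**: along an isomorphism, the successor of `resolve` at `S` and that of
`resolve` at `f⁻¹S` on the
pulled-back stage are isomorphic refined stages over the base isomorphism — INCLUDING THE MEMORY (the new pending
strict closures
correspond). [new] [folklore] -/
theorem RefStage.exists_resolveIso_comapAlong (S : TopologicalSpace.Closeds R.base.Y) :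
    ∃ ψ : RefStageIso (R.resolve n S).next ((R.comapAlong f).resolve n (S.preimage f.base.hom.continuous)).next,
      ψ.iso.hom ≫ blowup.π (singCentreOf S) = blowup.π (singCentreOf (S.preimage f.base.hom.continuous)) ≫ f := by
  obtain ⟨e, hsq, hct⟩ := exists_blowupIso_of_isIso f (singCentreOf S) R.base.I
    (C' := singCentreOf (S.preimage f.base.hom.continuous)) (singCentreOf_comap_of_isIso f S).symm n
  refine ⟨⟨e, hct.symm, ?_⟩, hsq⟩
  show some _ = some _
  rw [strictClosure_preimage_of_isIso R f S e hsq]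
  rfl

/-- **THE GRADED HOP'S FIRING BRANCH IS EQUIVARIANT**: along an isomorphism, the successors of `exit` at the surface
parts of the bad
closures correspond (the graded centre is carried, §T4). [new] [folklore] -/
theorem RefStage.exists_gradeExitIso_comapAlong :
    ∃ ψ : RefStageIso (R.exit n (surfacePart (badClosure n R.base))).next
        ((R.comapAlong f).exit n (surfacePart (badClosure n (R.comapAlong f).base))).next,
      ψ.iso.hom ≫ blowup.π (vanishingIdeal (surfacePart (badClosure n R.base))) =
        blowup.π (vanishingIdeal (surfacePart (badClosure n (R.comapAlong f).base))) ≫ f := by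
  have h : surfacePart (badClosure n (R.comapAlong f).base) = (surfacePart (badClosure n R.base)).preimage f.base.hom.continuous :=
    surfacePart_badClosure_comap_of_isIso f R.base.I n
  rw [h]
  exact R.exists_exitIso_comapAlong f n _

/-- **THE GRADED HOP IS EQUIVARIANT AT FIRING STAGES**: if `GradeNow n R` then `GradeNow n (f⁻¹R)` and the two
graded successors are
isomorphic refined stages over `f`. [new] [folklore] -/
theorem RefStage.exists_gHopIso_comapAlong_of_gradeNow (h : GradeNow n R) :
    GradeNow n (R.comapAlong f) ∧
      ∃ ψ : RefStageIso (gHop n R).next (gHop n (R.comapAlong f)).next, ψ.iso.hom ≫ (gHop n R).hom = (gHop n (R.comapAlong f)).hom ≫ f := by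
  have h' : GradeNow n (R.comapAlong f) := ((RefStageIso.ofComapAlong R f).gradeNow_iff n).mpr h
  refine ⟨h', ?_⟩
  rw [gHop, gHop, if_pos h, if_pos h']
  exact R.exists_gradeExitIso_comapAlong f n

/-- **THE ONE-CENTRE STEP** of a refined stage at a centre `C` — blow up `C`, pass to the controlled transform of
order `n`, law-state reset to
empty: the successor of ANY memoryless one-centre law (the shape of (T-a)'s class). DEFINITION (support). -/
abbrev RefStage.centreStep (n : ℕ) (R : RefStage) (C : R.base.Y.IdealSheafData) : RefStage :=
  ⟨⟨blowup C, controlledTransform (blowup.π C) C R.base.I n⟩, none⟩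

omit [IsIso f] in
/-- **THE ONE-CENTRE STEP IS EQUIVARIANT — LAW-AGNOSTIC** (pull-back form): if a law's centre is carried along the
isomorphism (`C' = f⁻¹C`),
then so is its successor, over the base isomorphism. This is the successor clause of (e-iso) for EVERY member of the
memoryless class at once;
the member-specific input is only the centre's equivariance (§T3–§T5). [new] [folklore] -/
theorem RefStage.exists_centreStepIso_comapAlong [IsIso f] (C : R.base.Y.IdealSheafData) {C' : Y'.IdealSheafData} (hC : C' = C.comap f) :
    ∃ ψ : RefStageIso (R.centreStep n C) ((R.comapAlong f).centreStep n C'), ψ.iso.hom ≫ blowup.π C = blowup.π C' ≫ f := by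
  obtain ⟨e, hsq, hct⟩ := exists_blowupIso_of_isIso f C R.base.I hC n
  exact ⟨⟨e, hct.symm, rfl⟩, hsq⟩

/-- **THE ONE-CENTRE STEP IS EQUIVARIANT — LAW-AGNOSTIC** (over an arbitrary `RefStageIso`). [new] [folklore] -/
theorem RefStageIso.exists_centreStepIso {R R' : RefStage} (φ : RefStageIso R R') [IsLocallyNoetherian R.base.Y] [IsLocallyNoetherian R'.base.Y]
    (n : ℕ) (C : R.base.Y.IdealSheafData) {C' : R'.base.Y.IdealSheafData} (hC : C' = C.comap φ.iso.hom) :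
    ∃ ψ : RefStageIso (R.centreStep n C) (R'.centreStep n C'), ψ.iso.hom ≫ blowup.π C = blowup.π C' ≫ φ.iso.hom := by
  obtain ⟨⟨Y', I'⟩, P'⟩ := R'
  obtain ⟨e, hI, hP⟩ := φ
  dsimp only at e hI hP C' hC ⊢
  subst hI
  haveI : IsLocallyNoetherian Y' := ‹_›
  exact R.exists_centreStepIso_comapAlong e.hom n C hC

end MTransportBlowup

section MTransportHops

open Scheme.IdealSheafData (vanishingIdeal)

/-! #### §T8 — THE HOPS ARE EQUIVARIANT: along an isomorphism of refined stages, the successors of the SEPARATING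
hop (stay / step 1 /
steps 1+2), of the REFINED hop (every branch) and of the GRADED hop are isomorphic refined stages OVER the base
isomorphism — the
SUCCESSOR half of the iso-equivariance axiom (e) for `gLaw` / `sepLaw`, PROVED -/

variable {X Y : Scheme.{0}}

/-- squares of base maps transport closures of preimages: `e⁻¹ (closure (π⁻¹ A)) = closure (π'⁻¹ (f⁻¹ A))` for `e ≫
π = π' ≫ f`, `e` an
isomorphism. [folklore] -/
theorem preimage_closure_preimage_of_sq {Z Z' : Scheme.{0}} (π : Z ⟶ Y) (π' : Z' ⟶ X) (f : X ⟶ Y) (e : Z' ≅ Z)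
    (hsq : e.hom ≫ π = π' ≫ f) (A : Set Y) :
    e.hom.base ⁻¹' closure (π.base ⁻¹' A) = closure (π'.base ⁻¹' (f.base ⁻¹' A)) := by
  have hfun : ∀ x, π.base (e.hom.base x) = f.base (π'.base x) := fun x => by
    change (e.hom ≫ π).base x = (π' ≫ f).base x
    rw [hsq]
  rw [e.hom.isOpenEmbedding.isOpenMap.preimage_closure_eq_closure_preimage e.hom.base.hom.continuous]
  congr 1
  ext x
  simp only [Set.mem_preimage, hfun]

/-- the top locus is carried along isomorphisms. [folklore] -/
theorem topLocusOf_comap_of_isIso (f : X ⟶ Y) [IsIso f] (I : Y.IdealSheafData) (n : ℕ) :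
    topLocusOf n ⟨X, I.comap f⟩ = f.base ⁻¹' topLocusOf n ⟨Y, I⟩ := by
  ext x
  simp only [topLocusOf, Set.mem_setOf_eq, Set.mem_preimage, idealOrder_comap_of_isIso_stalkMap f x I]

variable (R : RefStage) {Y' : Scheme.{0}} (f : Y' ⟶ R.base.Y) [IsIso f] [IsLocallyNoetherian Y'] [IsLocallyNoetherian R.base.Y] (n : ℕ)

omit [IsLocallyNoetherian Y'] [IsLocallyNoetherian R.base.Y] in
/-- the STEP-2 CENTRE is carried along the isomorphism of the step-1 stages: `oldTopCentre (f⁻¹R) = e₁⁻¹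
(oldTopCentre R)`. [folklore] -/
theorem oldTopCentre_comapAlong (e₁ : blowup (badClosureCentre n (R.comapAlong f).base) ≅ blowup (badClosureCentre n R.base))
    (hsq₁ : e₁.hom ≫ blowup.π (badClosureCentre n R.base) = blowup.π (badClosureCentre n (R.comapAlong f).base) ≫ f) :
    oldTopCentre n (R.comapAlong f).base = (oldTopCentre n R.base).comap e₁.hom := by
  rw [oldTopCentre, oldTopCentre, vanishingIdeal_comap_of_isIso]
  congr 1
  apply TopologicalSpace.Closeds.ext
  simp only [TopologicalSpace.Closeds.coe_mk, TopologicalSpace.Closeds.coe_preimage]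
  rw [preimage_closure_preimage_of_sq _ _ f e₁ hsq₁, topLocusOf_comap_of_isIso f R.base.I n,
    closure_badLocus_comap_of_isIso f R.base.I n]
  rfl

/-- **THE SEPARATING HOP IS EQUIVARIANT** (all three branches: stay, step 1, steps 1 + 2). [new] [folklore] -/
theorem RefStage.exists_sepIso_comapAlong :
    ∃ ψ : RefStageIso (R.sep n).next ((R.comapAlong f).sep n).next, ψ.iso.hom ≫ (R.sep n).hom = ((R.comapAlong f).sep n).hom ≫ f := by
  show ∃ ψ : RefStageIso ⟨(sepHop n R.base).next, none⟩ ⟨(sepHop n (R.comapAlong f).base).next, none⟩,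
    ψ.iso.hom ≫ (sepHop n R.base).hom = (sepHop n (R.comapAlong f).base).hom ≫ f
  by_cases hA : SepActive n R.base
  · have hA' : SepActive n (R.comapAlong f).base := (sepActive_comap_iff_of_isIso f R.base.I n).mpr hA
    obtain ⟨e₁, hsq₁, hct₁⟩ := exists_blowupIso_of_isIso f (badClosureCentre n R.base) R.base.I
      (C' := badClosureCentre n (R.comapAlong f).base) (badClosureCentre_comap_of_isIso f R.base.I n).symm n
    haveI : IsLocallyNoetherian (blowup (badClosureCentre n R.base)) := (blowup.isBlowup _).isLocallyNoetherian
    haveI : IsLocallyNoetherian (blowup (badClosureCentre n (R.comapAlong f).base)) := (blowup.isBlowup _).isLocallyNoetherian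
    have hC₂ := oldTopCentre_comapAlong R f n e₁ hsq₁
    by_cases hO : OldTopRegular n R.base
    · have hO' : OldTopRegular n (R.comapAlong f).base := by
        unfold OldTopRegular
        rw [hC₂]
        exact (isRegular_subscheme_comap_iff_of_isIso e₁.hom _).mpr hO
      obtain ⟨e₂, hsq₂, hct₂⟩ := exists_blowupIso_of_isIso e₁.hom (oldTopCentre n R.base) (stepOne n R.base).I hC₂ n
      rw [sepHop, sepHop, if_pos hA, if_pos hA', if_pos hO, if_pos hO']
      refine ⟨⟨e₂, ?_, rfl⟩, ?_⟩
      · show controlledTransform _ _ (stepOne n (R.comapAlong f).base).I n = _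
        rw [hct₂]
        exact congrArg (fun J => controlledTransform _ _ J n) hct₁.symm
      · show e₂.hom ≫ blowup.π _ ≫ blowup.π _ = (blowup.π _ ≫ blowup.π _) ≫ f
        rw [← Category.assoc, hsq₂, Category.assoc, hsq₁, Category.assoc]
    · have hO' : ¬ OldTopRegular n (R.comapAlong f).base := by
        unfold OldTopRegular
        rw [hC₂]
        exact fun h => hO ((isRegular_subscheme_comap_iff_of_isIso e₁.hom _).mp h)
      rw [sepHop, sepHop, if_pos hA, if_pos hA', if_neg hO, if_neg hO']
      exact ⟨⟨e₁, hct₁.symm, rfl⟩, hsq₁⟩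
  · have hA' : ¬ SepActive n (R.comapAlong f).base := fun h => hA ((sepActive_comap_iff_of_isIso f R.base.I n).mp h)
    rw [sepHop, sepHop, if_neg hA, if_neg hA']
    exact ⟨⟨asIso f, rfl, rfl⟩, by simp⟩

/-- **THE REFINED HOP IS EQUIVARIANT** (every branch: exit / resolve on a pending closure, resolve at a curve-frozen
level, separating
hop otherwise) — including the memory. [new] [folklore] -/
theorem RefStage.exists_refHopIso_comapAlong :
    ∃ ψ : RefStageIso (refHop n R).next (refHop n (R.comapAlong f)).next,
      ψ.iso.hom ≫ (refHop n R).hom = (refHop n (R.comapAlong f)).hom ≫ f := by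
  obtain ⟨⟨Y, I⟩, P⟩ := R
  cases P with
  | some S =>
    by_cases hS : ReducedRegular S
    · have hS' : ReducedRegular (S.preimage f.base.hom.continuous) := (reducedRegular_preimage_iff_of_isIso f S).mpr hS
      rw [refHop, refHop]
      simp only [Option.map_some]
      rw [if_pos hS, if_pos hS']
      exact RefStage.exists_exitIso_comapAlong ⟨⟨Y, I⟩, some S⟩ f n S
    · have hS' : ¬ ReducedRegular (S.preimage f.base.hom.continuous) :=
        fun h => hS ((reducedRegular_preimage_iff_of_isIso f S).mp h)
      rw [refHop, refHop]
      simp only [Option.map_some]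
      rw [if_neg hS, if_neg hS']
      exact RefStage.exists_resolveIso_comapAlong ⟨⟨Y, I⟩, some S⟩ f n S
  | none =>
    by_cases hC : CurveFrozen n (⟨Y, I⟩ : Stage)
    · have hC' : CurveFrozen n ((⟨⟨Y, I⟩, none⟩ : RefStage).comapAlong f).base := (curveFrozen_comap_iff_of_isIso f I n).mpr hC
      have hb : badClosure n ((⟨⟨Y, I⟩, none⟩ : RefStage).comapAlong f).base =
          (badClosure n (⟨Y, I⟩ : Stage)).preimage f.base.hom.continuous := badClosure_comap_of_isIso f I n
      rw [refHop, refHop, if_pos hC, if_pos hC', hb]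
      exact RefStage.exists_resolveIso_comapAlong ⟨⟨Y, I⟩, none⟩ f n _
    · have hC' : ¬ CurveFrozen n ((⟨⟨Y, I⟩, none⟩ : RefStage).comapAlong f).base :=
        fun h => hC ((curveFrozen_comap_iff_of_isIso f I n).mp h)
      rw [refHop, refHop, if_neg hC, if_neg hC']
      exact RefStage.exists_sepIso_comapAlong ⟨⟨Y, I⟩, none⟩ f n

/-- **THE GRADED HOP IS EQUIVARIANT**: along an isomorphism of refined stages the graded successors are isomorphic
refined stages over
the base isomorphism (firing branch by §T7, the refined hop otherwise) — the SUCCESSOR HALF of axiom (e-iso) for `gLaw`, PROVED.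
[new] [folklore] -/
theorem RefStage.exists_gHopIso_comapAlong :
    ∃ ψ : RefStageIso (gHop n R).next (gHop n (R.comapAlong f)).next, ψ.iso.hom ≫ (gHop n R).hom = (gHop n (R.comapAlong f)).hom ≫ f := by
  by_cases h : GradeNow n R
  · exact (R.exists_gHopIso_comapAlong_of_gradeNow f n h).2
  · have h' : ¬ GradeNow n (R.comapAlong f) := fun h'' => h (((RefStageIso.ofComapAlong R f).gradeNow_iff n).mp h'')
    rw [gHop, gHop, if_neg h, if_neg h']
    exact R.exists_refHopIso_comapAlong f n

/-- **(e-iso) FOR THE GRADED HOP, packaged over an arbitrary `RefStageIso`**: decision AND successor. [new] [folklore] -/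
theorem RefStageIso.exists_gHopIso {R R' : RefStage} (φ : RefStageIso R R') [IsLocallyNoetherian R.base.Y] [IsLocallyNoetherian R'.base.Y]
    (n : ℕ) :
    (GradeNow n R' ↔ GradeNow n R) ∧
      ∃ ψ : RefStageIso (gHop n R).next (gHop n R').next, ψ.iso.hom ≫ (gHop n R).hom = (gHop n R').hom ≫ φ.iso.hom := by
  refine ⟨φ.gradeNow_iff n, ?_⟩
  obtain ⟨⟨Y', I'⟩, P'⟩ := R'
  obtain ⟨e, hI, hP⟩ := φ
  dsimp only at e hI hP ⊢
  subst hI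
  rw [hP]
  haveI : IsLocallyNoetherian Y' := ‹_›
  exact R.exists_gHopIso_comapAlong e.hom n

/-- **(e-iso) FOR THE REFINED HOP, packaged over an arbitrary `RefStageIso`**. [new] [folklore] -/
theorem RefStageIso.exists_refHopIso {R R' : RefStage} (φ : RefStageIso R R') [IsLocallyNoetherian R.base.Y]
    [IsLocallyNoetherian R'.base.Y] (n : ℕ) :
    ∃ ψ : RefStageIso (refHop n R).next (refHop n R').next, ψ.iso.hom ≫ (refHop n R).hom = (refHop n R').hom ≫ φ.iso.hom := by
  obtain ⟨⟨Y', I'⟩, P'⟩ := R'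
  obtain ⟨e, hI, hP⟩ := φ
  dsimp only at e hI hP ⊢
  subst hI
  rw [hP]
  haveI : IsLocallyNoetherian Y' := ‹_›
  exact R.exists_refHopIso_comapAlong e.hom n

/-- **(e-iso) FOR THE SEPARATING HOP, packaged over an arbitrary `RefStageIso`**: decision (`SepActive`) AND
successor. [new] [folklore] -/
theorem RefStageIso.exists_sepIso {R R' : RefStage} (φ : RefStageIso R R') [IsLocallyNoetherian R.base.Y]
    [IsLocallyNoetherian R'.base.Y] (n : ℕ) :
    (SepActive n R'.base ↔ SepActive n R.base) ∧
      ∃ ψ : RefStageIso (R.sep n).next (R'.sep n).next, ψ.iso.hom ≫ (R.sep n).hom = (R'.sep n).hom ≫ φ.iso.hom := by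
  refine ⟨φ.sepActive_iff n, ?_⟩
  obtain ⟨⟨Y', I'⟩, P'⟩ := R'
  obtain ⟨e, hI, hP⟩ := φ
  dsimp only at e hI hP ⊢
  subst hI
  rw [hP]
  haveI : IsLocallyNoetherian Y' := ‹_›
  exact R.exists_sepIso_comapAlong e.hom n

end MTransportHops

end Summit.ResolutionOfSingularities.ResolutionOfSingularities.Theorems.DeltaCutClasses
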